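import Literature.NumberTheory.Automorphic.IrreducibleClassesComap
import Literature.NumberTheory.Automorphic.AdmissibleSubquotient
import HarnessLib

/-!
# Constituents of smooth representations: the irreducible case, inheritance, existence

Generic representation theory around the tree's ★ `IrrClass.IsConstituentOf c ρ` («`c ∈ Irr(G)` is the class of an
irreducible smooth SUBQUOTIENT `N₁ ⁄ N₂` of `ρ`», `Automorphic/UnitaryGroupBorelInduction` §5) — the constituent calculus
consumed by the global A-packet vocabulary of [Rogawski1990, §13.1] («`π_v` is a constituent of …» at every place `v`) and
its inner-form consumers (★ `Rogawski1990/CMLocalAPacketMembers`, ★ `IrreducibleClassesComap`):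
* §1 THE IRREDUCIBLE CASE: `(IrrClass.mk r).IsConstituentOf r.ρ` (as `⊤ ⁄ ⊥`); a constituent of an IRREDUCIBLE `ρ` is
  equivalent to `ρ` (`Subrepresentation ρ` is a simple order, so `N₁ = ⊤`, `N₂ = ⊥`), hence unique; for an irreducible
  smooth `ρ` on `V : Type` the constituents are exactly `{⟦ρ⟧}` (`isConstituentOf_iff_eq_mk`).
* §2 INHERITANCE: constituents pass along an INJECTIVE intertwining map `σ ↪ ρ` (`IsConstituentOf.of_injective`;
  subrepresentations) and back along a SURJECTIVE one `ρ ↠ τ` (`IsConstituentOf.of_surjective`; quotients), hence from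
  subquotients, are invariant under equivalence (`isConstituentOf_congr`), and all of this commutes with restriction along
  `φ : H →* G` (`IsConstituentOf.of_injective_comp`); an irreducible smooth `σ` OCCURRING in `ρ` (injective `σ → ρ`, the
  shape of ★ `DiscreteAutomorphicRep.HasFinComponent`) is a constituent of `ρ` (`isConstituentOf_mk_of_injective`).
* §3 EXISTENCE: a smooth representation on a non-trivial `V : Type` HAS a constituent (`exists_isConstituentOf`): the
  cyclic `ℂ[G]`-module through `v ≠ 0` is finitely generated, so it has a maximal proper `G`-stable subspace (★
  `Representation.exists_isCoatom_subrepresentation`) whose quotient is irreducible (★ `isIrreducible_quotientRep`) and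
  smooth (★ `IsSmooth.toRepresentation`∕`quotientRep`); variants through a non-zero subrepresentation and for a non-smooth
  `ρ` with non-zero smooth part (★ `smoothPart`).  So «every constituent of `ρ|_{G_v}` lies in `Π(ξ_v)`» is never
  vacuously true for a representation with a non-zero smooth vector (restriction along a CONTINUOUS homomorphism keeps
  smoothness: ★ `Representation.IsSmooth.comp`, imported).
Standard ([BushnellHenniart2006, §1.1–§2]; [BernsteinZelevinsky1976, §2.1]), fully proved; theorems only (no definition,
no named fact, no instance); nothing declared in Mathlib's namespaces.  NOT here: Jordan–Hölder ∕ finite length (★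
`AdmissibleSubquotient`), constituents of direct sums ∕ isotypic representations, anything automorphic.

## References
[BushnellHenniart2006] §1.1–1.2 (`Irr(G)`), §2 (subquotients) · [BernsteinZelevinsky1976] §2.1 · [Rogawski1990] §12.2
p. 173 («constituent of `i_G(χ)`»), §13.1 p. 199.
-/

set_option autoImplicit false

noncomputable section

open scoped MonoidAlgebra
open Literature.RepresentationTheory.FiniteGroups Literature.RepresentationTheory.Semisimple

namespace Literature.NumberTheory.Automorphic

namespace IrrClass

universe u u'

variable {G : Type u} [Group G] [TopologicalSpace G]

/-! ## §0 Private plumbing: three equivalences of (sub)quotient representations -/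

section Plumbing

variable {V W : Type*} [AddCommGroup V] [Module ℂ V] [AddCommGroup W] [Module ℂ W]

omit [TopologicalSpace G] in
/-- Quotients of one representation by EQUAL stable submodules are equivalent (the identity). [folklore] -/
private theorem nonempty_equiv_quotient_of_eq (ρ : Representation ℂ G V) {p q : Submodule ℂ V}
    (hp : ∀ g, p ≤ p.comap (ρ g)) (hq : ∀ g, q ≤ q.comap (ρ g)) (h : p = q) :
    Nonempty ((ρ.quotient p hp).Equiv (ρ.quotient q hq)) := by
  subst h
  exact ⟨Representation.Equiv.refl _⟩

omit [TopologicalSpace G] in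
/-- Every representation is its own subquotient `⊤ ⁄ ⊥`. [folklore] -/
private theorem nonempty_equiv_subquotient_top_bot (ρ : Representation ℂ G V) :
    Nonempty (ρ.Equiv ((⊤ : Subrepresentation ρ).toRepresentation.quotient
      ((⊥ : Subrepresentation ρ).toSubmodule.comap (⊤ : Subrepresentation ρ).toSubmodule.subtype)
      fun g _ hx ↦ (⊥ : Subrepresentation ρ).apply_mem_toSubmodule g hx)) := by
  have hP : (⊥ : Subrepresentation ρ).toSubmodule.comap (⊤ : Subrepresentation ρ).toSubmodule.subtype = ⊥ :=
    (Submodule.comap_bot _).trans (Submodule.ker_subtype _)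
  refine ⟨Representation.Equiv.mk
    ((Submodule.topEquiv (R := ℂ) (M := V)).symm.trans (Submodule.quotEquivOfEqBot _ hP).symm) fun g => ?_⟩
  refine LinearMap.ext fun v => ?_
  simp only [LinearMap.coe_comp, LinearEquiv.coe_coe, Function.comp_apply, LinearEquiv.trans_apply,
    Submodule.quotEquivOfEqBot_symm_apply]
  rfl

omit [TopologicalSpace G] in
/-- **Subquotients transport along an INJECTIVE intertwining map** `f : σ → ρ`: for `G`-stable `N₂ ≤ N₁` in `σ`, the
subquotient `N₁ ⁄ N₂` of `σ` is equivalent to the subquotient `f(N₁) ⁄ f(N₂)` of `ρ`. [folklore] -/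
private theorem nonempty_equiv_subquotient_map {σ : Representation ℂ G W} {ρ : Representation ℂ G V}
    (f : σ.IntertwiningMap ρ) (hf : Function.Injective f) (N₁ N₂ : Subrepresentation σ) (hle : N₂ ≤ N₁)
    (M₁ M₂ : Subrepresentation ρ) (hM₁ : M₁.toSubmodule = N₁.toSubmodule.map f.toLinearMap)
    (hM₂ : M₂.toSubmodule = N₂.toSubmodule.map f.toLinearMap) :
    Nonempty ((N₁.toRepresentation.quotient (N₂.toSubmodule.comap N₁.toSubmodule.subtype)
        fun g _ hx ↦ N₂.apply_mem_toSubmodule g hx).Equiv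
      (M₁.toRepresentation.quotient (M₂.toSubmodule.comap M₁.toSubmodule.subtype)
        fun g _ hx ↦ M₂.apply_mem_toSubmodule g hx)) := by
  -- the linear isomorphism `N₁ ≃ f(N₁) = M₁`
  let e₀ : ↥N₁.toSubmodule ≃ₗ[ℂ] ↥(N₁.toSubmodule.map f.toLinearMap) :=
    Submodule.equivMapOfInjective f.toLinearMap hf N₁.toSubmodule
  let e₁ : ↥N₁.toSubmodule ≃ₗ[ℂ] ↥M₁.toSubmodule := e₀.trans (LinearEquiv.ofEq _ _ hM₁.symm)
  have he₁ : ∀ x : ↥N₁.toSubmodule, ((e₁ x : ↥M₁.toSubmodule) : V) = f (x : W) := fun x => rfl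
  -- it carries `N₂ ∩ N₁` onto `M₂ ∩ M₁`
  have hPQ : (N₂.toSubmodule.comap N₁.toSubmodule.subtype).map (e₁ : ↥N₁.toSubmodule →ₗ[ℂ] ↥M₁.toSubmodule) =
      M₂.toSubmodule.comap M₁.toSubmodule.subtype := by
    ext y
    simp only [Submodule.mem_map, Submodule.mem_comap, Submodule.subtype_apply, LinearEquiv.coe_coe]
    constructor
    · rintro ⟨x, hx, rfl⟩
      rw [he₁, hM₂]
      exact ⟨(x : W), hx, rfl⟩
    · intro hy
      rw [hM₂] at hy
      obtain ⟨x, hx, hxy⟩ := hy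
      exact ⟨⟨x, hle hx⟩, hx, Subtype.ext ((he₁ _).trans hxy)⟩
  refine ⟨Representation.Equiv.mk (Submodule.Quotient.equiv _ _ e₁ hPQ) fun g => ?_⟩
  refine Submodule.linearMap_qext _ (LinearMap.ext fun x => ?_)
  simp only [LinearMap.coe_comp, LinearEquiv.coe_coe, Function.comp_apply, Submodule.mkQ_apply,
    Representation.quotient_apply, Submodule.mapQ_apply, Submodule.Quotient.equiv_apply]
  refine congrArg Submodule.Quotient.mk (Subtype.ext ?_)
  simp only [he₁, Subrepresentation.toRepresentation_apply_coe]
  exact Representation.IntertwiningMap.isIntertwining _ _ f g (x : W)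

omit [TopologicalSpace G] in
/-- **Subquotients transport back along a SURJECTIVE intertwining map** `f : ρ → τ`: for `G`-stable `N₂ ≤ N₁` in `τ`, the
subquotient `f⁻¹(N₁) ⁄ f⁻¹(N₂)` of `ρ` is equivalent to the subquotient `N₁ ⁄ N₂` of `τ`. [folklore] -/
private theorem nonempty_equiv_subquotient_comap {ρ : Representation ℂ G V} {τ : Representation ℂ G W}
    (f : ρ.IntertwiningMap τ) (hf : Function.Surjective f) (N₁ N₂ : Subrepresentation τ)
    (M₁ M₂ : Subrepresentation ρ) (hM₁ : M₁.toSubmodule = N₁.toSubmodule.comap f.toLinearMap)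
    (hM₂ : M₂.toSubmodule = N₂.toSubmodule.comap f.toLinearMap) :
    Nonempty ((N₁.toRepresentation.quotient (N₂.toSubmodule.comap N₁.toSubmodule.subtype)
        fun g _ hx ↦ N₂.apply_mem_toSubmodule g hx).Equiv
      (M₁.toRepresentation.quotient (M₂.toSubmodule.comap M₁.toSubmodule.subtype)
        fun g _ hx ↦ M₂.apply_mem_toSubmodule g hx)) := by
  -- the restriction `u : f⁻¹(N₁) → N₁` of `f`
  have hu : ∀ x : V, x ∈ M₁.toSubmodule → f.toLinearMap x ∈ N₁.toSubmodule := fun x hx => by rwa [hM₁] at hx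
  let u : ↥M₁.toSubmodule →ₗ[ℂ] ↥N₁.toSubmodule := f.toLinearMap.restrict hu
  have hu_apply : ∀ x : ↥M₁.toSubmodule, ((u x : ↥N₁.toSubmodule) : W) = f (x : V) := fun x => rfl
  set P : Submodule ℂ ↥N₁.toSubmodule := N₂.toSubmodule.comap N₁.toSubmodule.subtype with hPdef
  set P' : Submodule ℂ ↥M₁.toSubmodule := M₂.toSubmodule.comap M₁.toSubmodule.subtype with hP'def
  -- `mkQ ∘ u` is surjective with kernel `f⁻¹(N₂) ∩ f⁻¹(N₁)`
  have hsurj : Function.Surjective (P.mkQ ∘ₗ u) := by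
    intro y
    obtain ⟨y, rfl⟩ := Submodule.Quotient.mk_surjective _ y
    obtain ⟨x, hx⟩ := hf (y : W)
    have hxM : x ∈ M₁.toSubmodule := by
      rw [hM₁]
      exact show f x ∈ N₁.toSubmodule from hx ▸ y.2
    refine ⟨⟨x, hxM⟩, ?_⟩
    simp only [LinearMap.coe_comp, Function.comp_apply, Submodule.mkQ_apply]
    exact congrArg Submodule.Quotient.mk (Subtype.ext hx)
  have hker : P' = LinearMap.ker (P.mkQ ∘ₗ u) := by
    ext x
    rw [LinearMap.mem_ker, LinearMap.comp_apply, Submodule.mkQ_apply, Submodule.Quotient.mk_eq_zero, hP'def, hPdef,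
      Submodule.mem_comap, Submodule.mem_comap, Submodule.subtype_apply, Submodule.subtype_apply, hu_apply, hM₂,
      Submodule.mem_comap]
    rfl
  let χ : (↥M₁.toSubmodule ⧸ P') ≃ₗ[ℂ] (↥N₁.toSubmodule ⧸ P) :=
    (Submodule.quotEquivOfEq _ _ hker).trans (LinearMap.quotKerEquivOfSurjective _ hsurj)
  have hχ : ∀ x : ↥M₁.toSubmodule, χ (Submodule.Quotient.mk x) = Submodule.Quotient.mk (u x) := fun x => by
    simp only [χ, LinearEquiv.trans_apply, Submodule.quotEquivOfEq_mk, LinearMap.quotKerEquivOfSurjective_apply_mk,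
      LinearMap.coe_comp, Function.comp_apply, Submodule.mkQ_apply]
  refine ⟨(Representation.Equiv.mk χ fun g => ?_).symm⟩
  refine Submodule.linearMap_qext _ (LinearMap.ext fun x => ?_)
  simp only [LinearMap.coe_comp, LinearEquiv.coe_coe, Function.comp_apply, Submodule.mkQ_apply,
    Representation.quotient_apply, Submodule.mapQ_apply, hχ]
  refine congrArg Submodule.Quotient.mk (Subtype.ext ?_)
  simp only [hu_apply, Subrepresentation.toRepresentation_apply_coe]
  exact Representation.IntertwiningMap.isIntertwining _ _ f g (x : V)

end Plumbing

/-! ## §1 The irreducible case -/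

/-- **An irreducible smooth representation is a constituent of itself**: `⟦r⟧` is a constituent of `r.ρ`, realised as the
subquotient `⊤ ⁄ ⊥`. [cite: BushnellHenniart2006, §1.1] -/
theorem isConstituentOf_mk_self (r : SmoothIrrep G) : (IrrClass.mk r).IsConstituentOf r.ρ :=
  ⟨r, rfl, ⊤, ⊥, bot_le, nonempty_equiv_subquotient_top_bot r.ρ⟩

omit [TopologicalSpace G] in
/-- An irreducible representation lives on a non-trivial space (`⊥ ≠ ⊤` among its subrepresentations; «an irreducible
representation is by definition non-zero»). [cite: BushnellHenniart2006, §1.1] -/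
theorem nontrivial_of_isIrreducible {V : Type*} [AddCommGroup V] [Module ℂ V] (ρ : Representation ℂ G V)
    [ρ.IsIrreducible] : Nontrivial V := by
  have hne : (⊥ : Subrepresentation ρ) ≠ ⊤ := bot_ne_top
  have hne' : (⊥ : Submodule ℂ V) ≠ ⊤ := fun e ↦ hne (Subrepresentation.toSubmodule_injective e)
  exact (Submodule.nontrivial_iff ℂ).mp (nontrivial_of_ne _ _ hne')

/-- **A constituent of an IRREDUCIBLE representation is equivalent to it**: if `⟦r⟧` is a constituent of an irreducible `ρ`
then `r.ρ ≅ ρ` — the lattice `Subrepresentation ρ` is simple, so the subquotient `N₁ ⁄ N₂ ≅ r.ρ` (non-zero, `r.ρ` being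
irreducible) has `N₁ = ⊤`, `N₂ = ⊥`. [cite: BushnellHenniart2006, §1.1] -/
theorem IsConstituentOf.nonempty_equiv_of_isIrreducible {V : Type*} [AddCommGroup V] [Module ℂ V]
    {ρ : Representation ℂ G V} [ρ.IsIrreducible] {r : SmoothIrrep G} (h : (IrrClass.mk r).IsConstituentOf ρ) :
    Nonempty (r.ρ.Equiv ρ) := by
  obtain ⟨r', hr', N₁, N₂, hle, ⟨φ⟩⟩ := h
  obtain ⟨e₀⟩ := (IrrClass.mk_eq_mk_iff r r').1 hr'.symm
  haveI : Nontrivial r'.V := nontrivial_of_isIrreducible r'.ρ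
  -- the subquotient `N₁ ⁄ N₂ ≅ r'.ρ` is non-trivial
  have hnt : Nontrivial (↥N₁.toSubmodule ⧸ N₂.toSubmodule.comap N₁.toSubmodule.subtype) :=
    φ.toLinearEquiv.injective.nontrivial
  -- hence `N₁ = ⊤`
  have hN₁ : N₁ = ⊤ := by
    rcases IsSimpleOrder.eq_bot_or_eq_top N₁ with h₁ | h₁
    · exfalso
      subst h₁
      haveI : Subsingleton ↥(⊥ : Subrepresentation ρ).toSubmodule :=
        inferInstanceAs (Subsingleton ↥(⊥ : Submodule ℂ V))
      exact not_subsingleton _ ((Submodule.Quotient.mk_surjective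
        (N₂.toSubmodule.comap (⊥ : Subrepresentation ρ).toSubmodule.subtype)).subsingleton)
    · exact h₁
  -- and `N₂ = ⊥`
  have hN₂ : N₂ = ⊥ := by
    rcases IsSimpleOrder.eq_bot_or_eq_top N₂ with h₂ | h₂
    · exact h₂
    · exfalso
      subst h₂
      have htop : (⊤ : Subrepresentation ρ).toSubmodule.comap N₁.toSubmodule.subtype = ⊤ := Submodule.comap_top _
      exact not_subsingleton _ ((Submodule.Quotient.subsingleton_iff).2 htop)
  subst hN₁ hN₂
  obtain ⟨ψ⟩ := nonempty_equiv_subquotient_top_bot ρ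
  exact ⟨(e₀.trans φ).trans ψ.symm⟩

/-- Hence an irreducible representation has AT MOST ONE constituent. [cite: BushnellHenniart2006, §1.1] -/
theorem IsConstituentOf.eq_of_isIrreducible {V : Type*} [AddCommGroup V] [Module ℂ V] {ρ : Representation ℂ G V}
    [ρ.IsIrreducible] {c c' : IrrClass G} (h : c.IsConstituentOf ρ) (h' : c'.IsConstituentOf ρ) : c = c' := by
  obtain ⟨r, rfl⟩ := IrrClass.mk_surjective c
  obtain ⟨r', rfl⟩ := IrrClass.mk_surjective c'
  obtain ⟨e⟩ := h.nonempty_equiv_of_isIrreducible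
  obtain ⟨e'⟩ := h'.nonempty_equiv_of_isIrreducible
  exact IrrClass.mk_eq_mk_of_equiv (e.trans e'.symm)

/-- **The constituents of an irreducible smooth representation `ρ` on `V : Type` are exactly `{⟦ρ⟧}`.**
[cite: BushnellHenniart2006, §1.1] -/
theorem isConstituentOf_iff_eq_mk {V : Type} [AddCommGroup V] [Module ℂ V] (ρ : Representation ℂ G V)
    (hirr : ρ.IsIrreducible) (hsm : ρ.IsSmooth) (c : IrrClass G) :
    c.IsConstituentOf ρ ↔ c = IrrClass.mk { V := V, ρ := ρ, isIrreducible := hirr, isSmooth := hsm } := by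
  haveI := hirr
  constructor
  · intro h
    exact h.eq_of_isIrreducible (isConstituentOf_mk_self { V := V, ρ := ρ, isIrreducible := hirr, isSmooth := hsm })
  · rintro rfl
    exact isConstituentOf_mk_self _

/-! ## §2 Inheritance: injective and surjective intertwining maps, subquotients, equivalence, restriction -/

/-- **Constituents pass along INJECTIVE intertwining maps**: if `f : σ → ρ` is an injective `G`-map, every constituent of
`σ` is a constituent of `ρ` (the `G`-stable pair `N₂ ≤ N₁` of `σ` maps onto the pair `f(N₂) ≤ f(N₁)` of `ρ` with
`N₁ ⁄ N₂ ≅ f(N₁) ⁄ f(N₂)`). [cite: BushnellHenniart2006, §2] -/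
theorem IsConstituentOf.of_injective {V W : Type*} [AddCommGroup V] [Module ℂ V] [AddCommGroup W] [Module ℂ W]
    {σ : Representation ℂ G W} {ρ : Representation ℂ G V} (f : σ.IntertwiningMap ρ) (hf : Function.Injective f)
    {c : IrrClass G} (h : c.IsConstituentOf σ) : c.IsConstituentOf ρ := by
  obtain ⟨r, hr, N₁, N₂, hle, ⟨φ⟩⟩ := h
  have hstab : ∀ (N : Subrepresentation σ) (g : G) (v : V), v ∈ N.toSubmodule.map f.toLinearMap →
      ρ g v ∈ N.toSubmodule.map f.toLinearMap := by
    intro N g v hv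
    obtain ⟨x, hx, rfl⟩ := hv
    exact ⟨σ g x, N.apply_mem_toSubmodule g hx, Representation.IntertwiningMap.isIntertwining _ _ f g x⟩
  let M₁ : Subrepresentation ρ := ⟨N₁.toSubmodule.map f.toLinearMap, fun g v hv => hstab N₁ g v hv⟩
  let M₂ : Subrepresentation ρ := ⟨N₂.toSubmodule.map f.toLinearMap, fun g v hv => hstab N₂ g v hv⟩
  have hle' : M₂ ≤ M₁ := fun v hv => Submodule.map_mono (show N₂.toSubmodule ≤ N₁.toSubmodule from hle) hv
  obtain ⟨ψ⟩ := nonempty_equiv_subquotient_map f hf N₁ N₂ hle M₁ M₂ rfl rfl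
  exact ⟨r, hr, M₁, M₂, hle', ⟨φ.trans ψ⟩⟩

/-- Constituents of a SUBREPRESENTATION are constituents. [cite: BushnellHenniart2006, §2] -/
theorem IsConstituentOf.of_subrepresentation {V : Type*} [AddCommGroup V] [Module ℂ V] {ρ : Representation ℂ G V}
    (N : Subrepresentation ρ) {c : IrrClass G} (h : c.IsConstituentOf N.toRepresentation) : c.IsConstituentOf ρ :=
  h.of_injective (Subrepresentation.subtypeIntertwiningMap N) (Subrepresentation.subtypeIntertwiningMap_injective N)

/-- **Constituents pass back along SURJECTIVE intertwining maps**: if `f : ρ → τ` is a surjective `G`-map, every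
constituent of `τ` is a constituent of `ρ` (pull the pair `N₂ ≤ N₁` of `τ` back to `f⁻¹(N₂) ≤ f⁻¹(N₁)`, with
`f⁻¹(N₁) ⁄ f⁻¹(N₂) ≅ N₁ ⁄ N₂` since `ker f ≤ f⁻¹(N₂)`). [cite: BushnellHenniart2006, §2] -/
theorem IsConstituentOf.of_surjective {V W : Type*} [AddCommGroup V] [Module ℂ V] [AddCommGroup W] [Module ℂ W]
    {ρ : Representation ℂ G V} {τ : Representation ℂ G W} (f : ρ.IntertwiningMap τ) (hf : Function.Surjective f)
    {c : IrrClass G} (h : c.IsConstituentOf τ) : c.IsConstituentOf ρ := by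
  obtain ⟨r, hr, N₁, N₂, hle, ⟨φ⟩⟩ := h
  have hstab : ∀ (N : Subrepresentation τ) (g : G) (v : V), v ∈ N.toSubmodule.comap f.toLinearMap →
      ρ g v ∈ N.toSubmodule.comap f.toLinearMap := by
    intro N g v hv
    change f (ρ g v) ∈ N.toSubmodule
    rw [Representation.IntertwiningMap.isIntertwining _ _ f g v]
    exact N.apply_mem_toSubmodule g hv
  let M₁ : Subrepresentation ρ := ⟨N₁.toSubmodule.comap f.toLinearMap, fun g v hv => hstab N₁ g v hv⟩
  let M₂ : Subrepresentation ρ := ⟨N₂.toSubmodule.comap f.toLinearMap, fun g v hv => hstab N₂ g v hv⟩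
  have hle' : M₂ ≤ M₁ := fun v hv => Submodule.comap_mono (show N₂.toSubmodule ≤ N₁.toSubmodule from hle) hv
  obtain ⟨ψ⟩ := nonempty_equiv_subquotient_comap f hf N₁ N₂ M₁ M₂ rfl rfl
  exact ⟨r, hr, M₁, M₂, hle', ⟨φ.trans ψ⟩⟩

/-- Constituents of a QUOTIENT representation (★ `Subrepresentation.quotientRep`) are constituents.
[cite: BushnellHenniart2006, §2] -/
theorem IsConstituentOf.of_quotientRep {V : Type*} [AddCommGroup V] [Module ℂ V] {ρ : Representation ℂ G V}
    (N : Subrepresentation ρ) {c : IrrClass G} (h : c.IsConstituentOf N.quotientRep) : c.IsConstituentOf ρ :=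
  h.of_surjective N.mkQ N.mkQ_surjective

/-- Constituents of a SUBQUOTIENT `N₁ ⁄ (N₁ ⊓ N₂)` (the term of ★ `subquotientRep N₁ N₂`, spelled out) are constituents —
«a constituent of a constituent is a constituent». [cite: BushnellHenniart2006, §2] -/
theorem IsConstituentOf.of_subquotient {V : Type*} [AddCommGroup V] [Module ℂ V] {ρ : Representation ℂ G V}
    (N₁ N₂ : Subrepresentation ρ) {c : IrrClass G}
    (h : c.IsConstituentOf (N₁.toRepresentation.quotient (N₂.toSubmodule.comap N₁.toSubmodule.subtype)
      fun g _ hx ↦ N₂.apply_mem_toSubmodule g hx)) : c.IsConstituentOf ρ := by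
  let N₂' : Subrepresentation N₁.toRepresentation :=
    ⟨N₂.toSubmodule.comap N₁.toSubmodule.subtype, fun g _ hx ↦ N₂.apply_mem_toSubmodule g hx⟩
  exact ((show c.IsConstituentOf N₂'.quotientRep from h).of_quotientRep N₂').of_subrepresentation N₁

/-- **Constituents are invariant under equivalence of representations.** [cite: BushnellHenniart2006, §1.1] -/
theorem isConstituentOf_congr {V W : Type*} [AddCommGroup V] [Module ℂ V] [AddCommGroup W] [Module ℂ W]
    {σ : Representation ℂ G W} {ρ : Representation ℂ G V} (e : σ.Equiv ρ) (c : IrrClass G) :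
    c.IsConstituentOf σ ↔ c.IsConstituentOf ρ :=
  ⟨fun h => h.of_injective e.toIntertwiningMap e.toLinearEquiv.injective,
    fun h => h.of_injective e.symm.toIntertwiningMap e.symm.toLinearEquiv.injective⟩

/-- **An irreducible smooth representation OCCURRING in `ρ` is a constituent of `ρ`**: an injective `G`-map `σ → ρ` from
an irreducible smooth `σ` on `W : Type` (the shape of ★ `DiscreteAutomorphicRep.HasFinComponent`) makes `⟦σ⟧` a
constituent of `ρ`. [cite: BushnellHenniart2006, §2] -/
theorem isConstituentOf_mk_of_injective {V : Type*} [AddCommGroup V] [Module ℂ V] {W : Type} [AddCommGroup W]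
    [Module ℂ W] {σ : Representation ℂ G W} (hirr : σ.IsIrreducible) (hsm : σ.IsSmooth) {ρ : Representation ℂ G V}
    (f : σ.IntertwiningMap ρ) (hf : Function.Injective f) :
    (IrrClass.mk { V := W, ρ := σ, isIrreducible := hirr, isSmooth := hsm }).IsConstituentOf ρ :=
  (isConstituentOf_mk_self { V := W, ρ := σ, isIrreducible := hirr, isSmooth := hsm }).of_injective f hf

omit [TopologicalSpace G] in
/-- **Restriction along a group homomorphism commutes with inheritance**: for `φ : H →* G` and an injective `G`-map
`f : σ → ρ`, every constituent of `σ ∘ φ` is a constituent of `ρ ∘ φ` (`f` is also an `H`-map `σ ∘ φ → ρ ∘ φ`) — the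
shape «`σ ↪ P|_{U(𝔸_f)}` ⇒ the constituents of `σ|_{G_v}` are constituents of `P|_{G_v}`». [cite: BushnellHenniart2006, §2] -/
theorem IsConstituentOf.of_injective_comp {H : Type u'} [Group H] [TopologicalSpace H] {V W : Type*} [AddCommGroup V]
    [Module ℂ V] [AddCommGroup W] [Module ℂ W] {σ : Representation ℂ G W} {ρ : Representation ℂ G V} (φ : H →* G)
    (f : σ.IntertwiningMap ρ) (hf : Function.Injective f) {c : IrrClass H}
    (h : c.IsConstituentOf (σ.comp φ)) : c.IsConstituentOf (ρ.comp φ) :=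
  h.of_injective (σ := σ.comp φ) (ρ := ρ.comp φ) ⟨f.toLinearMap, fun x => f.isIntertwining' (φ x)⟩ hf

omit [TopologicalSpace G] in
/-- Surjective twin: for `φ : H →* G` and a surjective `G`-map `f : ρ → τ`, every constituent of `τ ∘ φ` is a constituent
of `ρ ∘ φ`. [cite: BushnellHenniart2006, §2] -/
theorem IsConstituentOf.of_surjective_comp {H : Type u'} [Group H] [TopologicalSpace H] {V W : Type*} [AddCommGroup V]
    [Module ℂ V] [AddCommGroup W] [Module ℂ W] {ρ : Representation ℂ G V} {τ : Representation ℂ G W} (φ : H →* G)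
    (f : ρ.IntertwiningMap τ) (hf : Function.Surjective f) {c : IrrClass H}
    (h : c.IsConstituentOf (τ.comp φ)) : c.IsConstituentOf (ρ.comp φ) :=
  h.of_surjective (ρ := ρ.comp φ) (τ := τ.comp φ) ⟨f.toLinearMap, fun x => f.isIntertwining' (φ x)⟩ hf

/-! ## §3 Existence -/

/-- **A smooth representation on a non-trivial space has a constituent.**  Through `v ≠ 0`: the cyclic `ℂ[G]`-module
`N₁ = ℂ[G]·v` is finitely generated, hence has a maximal proper `G`-stable subspace `N₂` (Mathlib: finite modules are
coatomic; ★ `Representation.exists_isCoatom_subrepresentation`), and `N₁ ⁄ N₂` is irreducible (★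
`Subrepresentation.isIrreducible_quotientRep`) and smooth (★ `IsSmooth.toRepresentation`, ★ `IsSmooth.quotientRep`).
[cite: BushnellHenniart2006, §2] -/
theorem exists_isConstituentOf [SeparatelyContinuousMul G] {V : Type} [AddCommGroup V] [Module ℂ V] [Nontrivial V]
    (ρ : Representation ℂ G V) (hρ : ρ.IsSmooth) : ∃ c : IrrClass G, c.IsConstituentOf ρ := by
  obtain ⟨v, hv⟩ := exists_ne (0 : V)
  -- the cyclic subrepresentation through `v`
  let S : Submodule ℂ[G] ρ.asModule := Submodule.span ℂ[G] {ρ.asModuleEquiv.symm v}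
  let N₁ : Subrepresentation ρ := Subrepresentation.ofSubmodule' S
  have hvS : ρ.asModuleEquiv.symm v ∈ S := Submodule.subset_span (Set.mem_singleton _)
  have hvN₁ : v ∈ N₁ := hvS
  haveI : Nontrivial ↥N₁.toSubmodule := ⟨⟨⟨v, hvN₁⟩, 0, fun h => hv (congrArg Subtype.val h)⟩⟩
  -- it is finitely generated over `ℂ[G]` (`N₁.toRepresentation.asModule ≃ N₁.asSubmodule = S = ℂ[G] ∙ v`)
  haveI : Module.Finite ℂ[G] ↥S := Module.Finite.span_singleton ℂ[G] _
  have hS : S = N₁.asSubmodule := rfl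
  haveI : Module.Finite ℂ[G] N₁.toRepresentation.asModule :=
    Module.Finite.equiv ((LinearEquiv.ofEq _ _ hS).trans (Subrepresentation.asModuleEquiv N₁).symm)
  -- so it has a maximal proper subrepresentation, with irreducible smooth quotient
  obtain ⟨N₂', hN₂'⟩ := Representation.exists_isCoatom_subrepresentation N₁.toRepresentation
  have hirr : N₂'.quotientRep.IsIrreducible := Subrepresentation.isIrreducible_quotientRep hN₂'
  have hsm : N₂'.quotientRep.IsSmooth := (hρ.toRepresentation N₁).quotientRep N₂'
  let r : SmoothIrrep G :=
    { V := ↥N₁.toSubmodule ⧸ N₂'.toSubmodule, ρ := N₂'.quotientRep, isIrreducible := hirr, isSmooth := hsm }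
  -- read `N₂'` as a subrepresentation `N₂ ≤ N₁` of `ρ`
  let N₂ : Subrepresentation ρ :=
    ⟨N₂'.toSubmodule.map N₁.toSubmodule.subtype, fun g w hw => by
      obtain ⟨x, hx, rfl⟩ := hw
      exact ⟨N₁.toRepresentation g x, N₂'.apply_mem_toSubmodule g hx, rfl⟩⟩
  have hle : N₂ ≤ N₁ := fun w hw => by obtain ⟨x, -, rfl⟩ := hw; exact x.2
  have hcomap : N₂.toSubmodule.comap N₁.toSubmodule.subtype = N₂'.toSubmodule :=
    Submodule.comap_map_eq_of_injective (Submodule.injective_subtype _) _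
  exact ⟨IrrClass.mk r, r, rfl, N₁, N₂, hle,
    nonempty_equiv_quotient_of_eq N₁.toRepresentation N₂'.le_comap_toSubmodule _ hcomap.symm⟩

/-- Through any NON-ZERO subrepresentation `N` of a smooth `ρ` there is a constituent of `N` (hence of `ρ`,
`IsConstituentOf.of_subrepresentation`). [cite: BushnellHenniart2006, §2] -/
theorem exists_isConstituentOf_toRepresentation [SeparatelyContinuousMul G] {V : Type} [AddCommGroup V] [Module ℂ V]
    (ρ : Representation ℂ G V) (hρ : ρ.IsSmooth) (N : Subrepresentation ρ) (hN : N ≠ ⊥) :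
    ∃ c : IrrClass G, c.IsConstituentOf N.toRepresentation := by
  haveI : Nontrivial ↥N.toSubmodule :=
    Submodule.nontrivial_iff_ne_bot.2 fun h => hN (Subrepresentation.toSubmodule_injective h)
  exact exists_isConstituentOf N.toRepresentation (hρ.toRepresentation N)

/-- A representation (smooth or not) with a NON-ZERO SMOOTH VECTOR has a constituent: apply `exists_isConstituentOf` to the
smooth part (★ `Representation.smoothPart`, ★ `isSmooth_smoothPart`) and inherit. [cite: BernsteinZelevinsky1976, §2.1] -/
theorem exists_isConstituentOf_of_smoothPart_ne_bot [SeparatelyContinuousMul G] {V : Type} [AddCommGroup V]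
    [Module ℂ V] (ρ : Representation ℂ G V) (h : ρ.smoothPart ≠ ⊥) : ∃ c : IrrClass G, c.IsConstituentOf ρ := by
  haveI : Nontrivial ↥ρ.smoothPart.toSubmodule :=
    Submodule.nontrivial_iff_ne_bot.2 fun h' => h (Subrepresentation.toSubmodule_injective h')
  obtain ⟨c, hc⟩ := exists_isConstituentOf ρ.smoothPart.toRepresentation ρ.isSmooth_smoothPart
  exact ⟨c, hc.of_subrepresentation _⟩

/-- NON-VACUITY of «every constituent satisfies `P`»: for a smooth representation on a non-trivial space, `∀ c,
c.IsConstituentOf ρ → P c` yields a constituent satisfying `P`. [cite: BushnellHenniart2006, §2] -/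
theorem exists_isConstituentOf_and [SeparatelyContinuousMul G] {V : Type} [AddCommGroup V] [Module ℂ V] [Nontrivial V]
    (ρ : Representation ℂ G V) (hρ : ρ.IsSmooth) {P : IrrClass G → Prop} (hP : ∀ c, c.IsConstituentOf ρ → P c) :
    ∃ c : IrrClass G, c.IsConstituentOf ρ ∧ P c := by
  exact (exists_isConstituentOf ρ hρ).imp fun c hc => ⟨hc, hP c hc⟩

end IrrClass

end Literature.NumberTheory.Automorphic

end
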